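import Summits.MatrixMultiplication.OmegaCensus.STPPVosperSlackTwoCheckersSound2
import Summits.MatrixMultiplication.OmegaCensus.STPPVosperSlackTwoShapes

/-!
# ω-census (abelian STPP census): SOUNDNESS of the slack-2 case-A checker in normal form (kernel tool)

HONEST FRAMING (pub-omega census; verbatim): lottery ticket; floor = certified bounds/negative ranges.
Census STRUCTURE (seat pub-omega-stpp-1 gen 32, 2026-08-28), family (b2).  `caseADeadQ'_false_of_normal_form`: a two-block STPP family of `ℤ/p` in the
normal form of the slack-2 partition law (HOME `pub-omega-stpp-1-g32/SLACK2-DESIGN.md`: `A 0 = [0,a)`, `0 ∈ C 0`, `0 ∈ B 1`, `Y° = y + [0,L)`) makes the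
checker `caseADeadQ'` of `STPPVosperSlackTwoCheckers.lean` return `false` on the value list of `B 0` — assembled from the control-flow lemmas
(`caseALeaf_of_caseADeadQ'`, `realisationsDead_of_caseALeaf`, `isSTPPb_false_of_realisationsDead`, `isSTPPb_of_isSTPP`, `tilesAll_complete` via
`admissible_filter_transMasks`), the bit-set meaning lemmas (`STPPKernelBitsets.lean`, `…CheckersSound.lean` §10–§14) and the three-set disjointness of
the dual N18 chain (`disjoint_W_negA_add_DU`, `disjoint_negB_add_DU_AC`).  What remains for the law: the REDUCTION of a case-(A) family
(`slack_two_shapes`) to normal form by the `N + 2` translation freedoms and the dilation, the analogous lemma for the case-C checker, and the decide rows.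
UNCONDITIONAL; no `decide`.  Nothing here is progress on `ω`.

References: H. Cohn, R. Kleinberg, B. Szegedy, C. Umans, FOCS 2005 (arXiv:math/0511460), Def. 5.1; A. G. Vosper, J. London Math. Soc. 31 (1956).
-/

open Finset
open scoped Pointwise

namespace Summit.MatrixMultiplication.OmegaCensus.CubeNB.S2

open Literature.Computability.AlgebraicComplexity
open Literature.Combinatorics.Additive
open Summit.MatrixMultiplication.OmegaCensus.STPPKneser
open Summit.MatrixMultiplication.OmegaCensus.CubeNB.Bits

variable {p : ℕ} [hp : Fact p.Prime]

/-- **NORMAL-FORM SOUNDNESS of the case-A checker.**  For a two-block STPP family in `ℤ/p` in normal form — `A 0 = {0, 1, …, a−1}`, `0 ∈ C 0`,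
`0 ∈ B 1`, `Y° = C 1 − B 1 = {y, y+1, …, y+L−1}` (`L = #B1·#C1`, `z = #A1·#C1`, `a + L ≤ p`) — the case-A checker `caseADeadQ'` does NOT return `true`
on the value list of `B 0`: the family itself passes every stage (pattern packing, the interval `SY`, the tiling `W = ⊔_{c ∈ C 0}(c − A 0 − B 0)` as an
admissible choice sequence, `Z° ⊆` candidates because `T = −B 0 + Z°` misses `W ∪ SY`, the realisation of block `1`, and `isSTPPb` by `isSTPPb_of_isSTPP`).
[cite: CohnKleinbergSzegedyUmans2005, Def. 5.1] -/
theorem caseADeadQ'_false_of_normal_form {A B C : Fin 2 → Finset (ZMod p)} (hS : IsSTPP A B C)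
    (hA : ∀ k, (A k).Nonempty) (hB : ∀ k, (B k).Nonempty) (hC : ∀ k, (C k).Nonempty)
    {a c L z a₀ b₀ c₀ : ℕ} (ha : #(A 0) = a) (hc : #(C 0) = c) (ha₀ : #(A 1) = a₀) (hb₀ : #(B 1) = b₀) (hc₀ : #(C 1) = c₀)
    (hL : b₀ * c₀ = L) (hz : a₀ * c₀ = z) (hap : a + L ≤ p)
    (hA0 : A 0 = (Finset.range a).image fun k : ℕ => (k : ZMod p)) (hC00 : (0 : ZMod p) ∈ C 0)
    (hB10 : (0 : ZMod p) ∈ B 1) {y : ZMod p} (hY : DU B C (univ.erase 0) = (Finset.range L).image fun t : ℕ => y + (t : ZMod p)) :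
    caseADeadQ' p a c L z a₀ b₀ c₀ (((B 0).image ZMod.val).sort (· ≤ ·)) = false := by
  rw [Bool.eq_false_iff]; intro h
  have hp0 : 0 < p := hp.out.pos; have h1 : (univ : Finset (Fin 2)).erase 0 = {1} := by decide
  have ha1 : 1 ≤ a := by rw [← ha]; exact (hA 0).card_pos
  have hL1 : 1 ≤ L := by rw [← hL]; exact Nat.mul_pos (by rw [← hb₀]; exact (hB 1).card_pos) (by rw [← hc₀]; exact (hC 1).card_pos)
  have hap' : a < p := by omega
  set Q := ((B 0).image ZMod.val).sort (· ≤ ·) with hQdef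
  obtain ⟨hQmem, hQnd, hQlt, hQlen⟩ := valList_spec (B 0)
  have hA0mem : ∀ x : ℕ, x < a → (x : ZMod p) ∈ A 0 := fun x hx => by rw [hA0]; exact mem_image.2 ⟨x, mem_range.2 hx, rfl⟩
  set patt := pattPQ p (List.range a) Q with hpattdef
  have hpatt_mem : ∀ w, w ∈ patt ↔ ∃ x : ℕ, x < a ∧ ∃ b ∈ B 0, (x + b.val) % p = w := by
    intro w; rw [hpattdef, pattPQ, List.mem_flatMap]
    constructor
    · rintro ⟨x, hx, hw⟩
      rw [List.mem_map] at hw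
      obtain ⟨q, hq, rfl⟩ := hw
      obtain ⟨b, hb, rfl⟩ := (hQmem q).1 hq
      exact ⟨x, List.mem_range.1 hx, b, hb, rfl⟩
    · rintro ⟨x, hx, b, hb, rfl⟩
      exact ⟨x, List.mem_range.2 hx, List.mem_map.2 ⟨b.val, (hQmem _).2 ⟨b, hb, rfl⟩, rfl⟩⟩
  have hpatt_cast : ∀ (x : ℕ) (b : ZMod p), ((((x + b.val) % p : ℕ)) : ZMod p) = (x : ZMod p) + b := fun x b => by
    rw [cast_add_mod, ZMod.natCast_zmod_val]
  have hpatt : patt.Nodup := by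
    rw [hpattdef, pattPQ, List.nodup_flatMap]
    constructor
    · intro x hx
      refine List.Nodup.map_on (fun q hq q' hq' hqq => ?_) hQnd
      have hq1 := hQlt q hq
      have hq2 := hQlt q' hq'
      have := congrArg (fun n : ℕ => (n : ZMod p)) hqq
      simp only [cast_add_mod, add_right_inj] at this
      have := congrArg ZMod.val this
      rwa [ZMod.val_natCast_of_lt hq1, ZMod.val_natCast_of_lt hq2] at this
    · refine (List.nodup_range (n := a)).imp_of_mem ?_
      intro x x' hx hx' hne v hv hv'
      rw [List.mem_map] at hv hv'
      obtain ⟨q, hq, rfl⟩ := hv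
      obtain ⟨q', hq', hqq⟩ := hv'
      obtain ⟨b, hb, rfl⟩ := (hQmem q).1 hq
      obtain ⟨b', hb', rfl⟩ := (hQmem q').1 hq'
      have hcast := congrArg (fun n : ℕ => (n : ZMod p)) hqq
      simp only [hpatt_cast] at hcast
      have hxlt := List.mem_range.1 hx
      have hxlt' := List.mem_range.1 hx'
      obtain ⟨hxx, -⟩ := add_injOn_AB hS hC 0 (hA0mem x' hxlt') (hA0mem x hxlt) hb' hb hcast
      have := congrArg ZMod.val hxx
      rw [ZMod.val_natCast_of_lt (by omega), ZMod.val_natCast_of_lt (by omega)] at this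
      exact hne this.symm
  set s0 := (y.val + p - (a - 1)) % p with hs0
  have hs0p : s0 < p := Nat.mod_lt _ hp0
  have hs0cast : ((s0 : ℕ) : ZMod p) = y - ((a - 1 : ℕ) : ZMod p) := by
    rw [hs0, cast_mod_self, Nat.cast_sub (by have := y.val_lt; omega)]
    push_cast
    rw [ZMod.natCast_zmod_val, ZMod.natCast_self]; ring
  set ivl := maskOf ((List.range (a + L - 1)).map fun t => (s0 + t) % p) with hivl
  have hssm : (s0, ivl) ∈ ivlMasks p (a + L - 1) := mem_ivlMasks.2 ⟨s0, hs0p, rfl⟩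
  set W := ((A 0) ×ˢ ((B 0) ×ˢ (C 0))).image fun q : ZMod p × ZMod p × ZMod p => (0 : ZMod p) + q.2.2 - q.1 - q.2.1 with hW
  set SY := (A 0).image (fun x => (0 : ZMod p) - x) + DU B C (univ.erase 0) with hSY
  set T := (B 0).image (fun x => (0 : ZMod p) - x) + DU A C (univ.erase 0) with hT
  have hWSY : Disjoint W SY := disjoint_W_negA_add_DU hS 0
  have hTWSY : Disjoint T (W ∪ SY) := disjoint_negB_add_DU_AC hS 0
  have hmemW : ∀ x ∈ A 0, ∀ b ∈ B 0, ∀ cc ∈ C 0, cc - x - b ∈ W := fun x hx b hb cc hcc =>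
    mem_image.2 ⟨(x, b, cc), mem_product.2 ⟨hx, mem_product.2 ⟨hb, hcc⟩⟩, by ring⟩
  have hmemSY : ∀ t, t < a + L - 1 → ((((s0 + t) % p : ℕ)) : ZMod p) ∈ SY := by
    intro t ht; rw [cast_add_mod, hs0cast]
    by_cases hta : t ≤ a - 1
    · -- `k = a − 1 − t`, `t′ = 0`
      have hk : ((a - 1 - t : ℕ) : ZMod p) ∈ A 0 := hA0mem _ (by omega)
      have hy0 : y + ((0 : ℕ) : ZMod p) ∈ DU B C (univ.erase 0) := by rw [hY]; exact mem_image.2 ⟨0, mem_range.2 (by omega), rfl⟩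
      have hneg : (0 : ZMod p) - ((a - 1 - t : ℕ) : ZMod p) ∈ (A 0).image (fun x => (0 : ZMod p) - x) := mem_image.2 ⟨_, hk, rfl⟩
      have := Finset.add_mem_add hneg hy0
      convert this using 1
      have e1 : ((a - 1 - t : ℕ) : ZMod p) = ((a - 1 : ℕ) : ZMod p) - t := by rw [Nat.cast_sub hta]
      rw [e1]; push_cast; ring
    · have hk : ((0 : ℕ) : ZMod p) ∈ A 0 := hA0mem 0 (by omega)
      have hy0 : y + ((t - (a - 1) : ℕ) : ZMod p) ∈ DU B C (univ.erase 0) := by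
        rw [hY]; exact mem_image.2 ⟨t - (a - 1), mem_range.2 (by omega), rfl⟩
      have hneg : (0 : ZMod p) - ((0 : ℕ) : ZMod p) ∈ (A 0).image (fun x => (0 : ZMod p) - x) := mem_image.2 ⟨_, hk, rfl⟩
      have := Finset.add_mem_add hneg hy0
      convert this using 1
      have e2 : ((t - (a - 1) : ℕ) : ZMod p) = (t : ZMod p) - ((a - 1 : ℕ) : ZMod p) := by rw [Nat.cast_sub (by omega)]
      rw [e2]; push_cast; ring
  have hT0 : ((transMasks p patt).headD (0, 0)).2 = maskOf (patt.map fun w => (0 + p - w) % p) := transMasks_headD patt hp0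
  have htrans_mem : ∀ (r w : ℕ) (cc : ZMod p), cc.val = r → w ∈ patt →
      ∃ x ∈ A 0, ∃ b ∈ B 0, ((((r + p - w) % p : ℕ)) : ZMod p) = cc - x - b := by
    intro r w cc hr hw
    obtain ⟨x, hx, b, hb, rfl⟩ := (hpatt_mem w).1 hw
    refine ⟨x, hA0mem x hx, b, hb, ?_⟩; rw [cast_add_sub_mod (by have := Nat.mod_lt (x + b.val) hp0; omega), hpatt_cast, ← hr, ZMod.natCast_zmod_val]; ring
  have hdisj : disjB ivl ((transMasks p patt).headD (0, 0)).2 = true := by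
    rw [hT0, disjB_eq_true_iff]
    rintro v ⟨hv1, hv2⟩
    obtain ⟨t, ht, rfl⟩ := (tb_ivlMask p s0 (a + L - 1) v).1 hv1
    obtain ⟨w, hw, hwv⟩ := (tb_transMask p patt 0 _).1 hv2
    obtain ⟨x, hx, b, hb, hval⟩ := htrans_mem 0 w 0 (ZMod.val_zero) hw
    rw [hwv] at hval
    have hinW : ((((s0 + t) % p : ℕ)) : ZMod p) ∈ W := by rw [hval]; exact hmemW x hx b hb 0 hC00
    exact Finset.disjoint_left.1 hWSY hinW (hmemSY t ht)
  set RS := ((C 0).erase 0).image ZMod.val with hRS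
  have hRSmem : ∀ r, r ∈ RS ↔ ∃ cc ∈ C 0, cc ≠ 0 ∧ cc.val = r := by
    intro r; rw [hRS, mem_image]
    constructor
    · rintro ⟨cc, hcc, rfl⟩; exact ⟨cc, (mem_erase.1 hcc).2, (mem_erase.1 hcc).1, rfl⟩
    · rintro ⟨cc, hcc, hne, rfl⟩; exact ⟨cc, mem_erase.2 ⟨hne, hcc⟩, rfl⟩
  obtain ⟨hsub, hlen, hadm, hmemrs⟩ := admissible_filter_transMasks p patt
    (((transMasks p patt).headD (0, 0)).2 ||| ivl) RS
    (by
      intro r hr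
      obtain ⟨cc, hcc, hne, rfl⟩ := (hRSmem r).1 hr
      refine ⟨Nat.one_le_iff_ne_zero.2 fun h0 => hne ((ZMod.val_eq_zero cc).1 h0), cc.val_lt⟩)
    (by
      intro r hr w hw
      obtain ⟨cc, hcc, hne, hr'⟩ := (hRSmem r).1 hr
      obtain ⟨x, hx, b, hb, hval⟩ := htrans_mem r w cc hr' hw
      have hinW : ((((r + p - w) % p : ℕ)) : ZMod p) ∈ W := by rw [hval]; exact hmemW x hx b hb cc hcc
      rw [Bool.eq_false_iff]
      intro htb
      rw [tb_lor, Bool.or_eq_true, hT0] at htb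
      rcases htb with htb | htb
      · obtain ⟨w', hw', hwv⟩ := (tb_transMask p patt 0 _).1 htb
        obtain ⟨x', hx', b', hb', hval'⟩ := htrans_mem 0 w' 0 (ZMod.val_zero) hw'
        rw [hwv, hval] at hval'
        obtain ⟨-, -, hc0⟩ := blockSum_inj hS 0 hx hx' hb hb' hcc hC00 hval'
        exact hne hc0
      · obtain ⟨t, ht, htv⟩ := (tb_ivlMask p s0 (a + L - 1) _).1 htb
        have hinSY := hmemSY t ht
        rw [htv] at hinSY
        exact Finset.disjoint_left.1 hWSY hinW hinSY)
    (by
      intro r hr r' hr' hne w hw w' hw' heq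
      obtain ⟨cc, hcc, _, hrv⟩ := (hRSmem r).1 hr
      obtain ⟨cc', hcc', _, hrv'⟩ := (hRSmem r').1 hr'
      obtain ⟨x, hx, b, hb, hval⟩ := htrans_mem r w cc hrv hw
      obtain ⟨x', hx', b', hb', hval'⟩ := htrans_mem r' w' cc' hrv' hw'
      rw [heq, hval'] at hval
      obtain ⟨-, -, hccc⟩ := blockSum_inj hS 0 hx' hx hb' hb hcc' hcc hval
      exact hne (by rw [← hrv, ← hrv', hccc]))
  have hlen' : (((transMasks p patt).drop 1).filter fun x => decide (x.1 ∈ RS)).length = c - 1 := by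
    rw [hlen, hRS, Finset.card_image_of_injective _ (ZMod.val_injective p), Finset.card_erase_of_mem hC00, hc]
  set rs := ((transMasks p patt).drop 1).filter fun x => decide (x.1 ∈ RS) with hrs
  have hleaf := caseALeaf_of_caseADeadQ' h hpatt _ hssm hdisj rs hsub hlen' hadm
  set cov := rs.foldl (fun cv x => cv ||| x.2) (((transMasks p patt).headD (0, 0)).2 ||| ivl) with hcov
  have hcov_mem : ∀ v, tb cov v = true → ∃ e ∈ W ∪ SY, e.val = v := by
    intro v hv
    rw [hcov, tb_foldl_lor] at hv
    rcases hv with hv | ⟨x, hx, hv⟩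
    · rw [tb_lor, Bool.or_eq_true, hT0] at hv
      rcases hv with hv | hv
      · obtain ⟨w, hw, hwv⟩ := (tb_transMask p patt 0 _).1 hv
        obtain ⟨x, hx, b, hb, hval⟩ := htrans_mem 0 w 0 (ZMod.val_zero) hw
        refine ⟨0 - x - b, mem_union_left _ (hmemW x hx b hb 0 hC00), ?_⟩; rw [← hval, ZMod.val_natCast, Nat.mod_mod, hwv]
      · obtain ⟨t, ht, htv⟩ := (tb_ivlMask p s0 (a + L - 1) _).1 hv
        refine ⟨_, mem_union_right _ (hmemSY t ht), ?_⟩; rw [ZMod.val_natCast, Nat.mod_mod, htv]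
    · obtain ⟨hx1, hxe⟩ := (hmemrs x).1 hx
      obtain ⟨cc, hcc, _, hrv⟩ := (hRSmem _).1 hx1
      rw [hxe] at hv
      obtain ⟨w, hw, hwv⟩ := (tb_transMask p patt x.1 _).1 hv
      obtain ⟨x', hx', b, hb, hval⟩ := htrans_mem x.1 w cc hrv hw
      refine ⟨cc - x' - b, mem_union_left _ (hmemW x' hx' b hb cc hcc), ?_⟩; rw [← hval, ZMod.val_natCast, Nat.mod_mod, hwv]
  have hcov_lt : cov < 2 ^ p := by
    refine Nat.lt_pow_two_of_testBit _ fun i hi => ?_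
    rw [← tb_eq_testBit, Bool.eq_false_iff]
    intro htb
    obtain ⟨e, _, hev⟩ := hcov_mem i htb
    have := e.val_lt; omega
  have hM : fullMask p ^^^ cov < 2 ^ p := by
    rw [fullMask_eq]; exact Nat.xor_lt_two_pow (by have := Nat.one_le_two_pow (n := p); omega) hcov_lt
  set zc := Q.foldl (fun m q => m &&& rot p (fullMask p ^^^ cov) q) (fullMask p) with hzc
  have hZmem : ∀ ζ ∈ DU A C (univ.erase 0), ζ.val ∈ members (List.range p) zc := by
    intro ζ hζ; rw [mem_members, List.mem_range]
    refine ⟨ζ.val_lt, ?_⟩; rw [hzc, tb_foldl_land_rot hM hQlt ζ.val_lt]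
    intro q hq
    obtain ⟨b, hb, rfl⟩ := (hQmem q).1 hq
    have hlt : (ζ.val + p - b.val) % p < p := Nat.mod_lt _ hp0
    rw [tb_compl hlt, Bool.not_eq_true', Bool.eq_false_iff]
    intro htb
    obtain ⟨e, he, hev⟩ := hcov_mem _ htb
    have hecast : e = ζ - b := by
      have := congrArg (fun n : ℕ => (n : ZMod p)) hev
      simp only [ZMod.natCast_zmod_val] at this
      rw [this, cast_add_sub_mod (by have := b.val_lt; omega), ZMod.natCast_zmod_val, ZMod.natCast_zmod_val]
    have hinT : ζ - b ∈ T := by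
      have hneg : (0 : ZMod p) - b ∈ (B 0).image (fun x => (0 : ZMod p) - x) := mem_image.2 ⟨b, hb, rfl⟩
      have := Finset.add_mem_add hneg hζ
      convert this using 1; ring
    rw [hecast] at he
    exact Finset.disjoint_left.1 hTWSY hinT he
  set Zo := (members (List.range p) zc).filter fun v => decide (v ∈ (DU A C (univ.erase 0)).image ZMod.val) with hZo
  have hZcard : #(DU A C (univ.erase 0)) = z := by rw [card_DU_AC hS hB, h1, sum_singleton, ha₀, hc₀, hz]
  have hZomem : Zo ∈ (members (List.range p) zc).sublistsLen z := by
    rw [← hZcard, ← card_image_of_injective (DU A C (univ.erase 0)) (ZMod.val_injective p)]; exact filter_mem_sublistsLen _ (nodup_members List.nodup_range _) _ fun v hv => by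
      obtain ⟨ζ, hζ, rfl⟩ := mem_image.1 hv
      exact hZmem ζ hζ
  have hZo_mem : ∀ v, v ∈ Zo ↔ ∃ ζ ∈ DU A C (univ.erase 0), ζ.val = v := by
    intro v; rw [hZo, List.mem_filter, decide_eq_true_eq, mem_image]
    constructor
    · exact fun h => h.2
    · rintro ⟨ζ, hζ, rfl⟩; exact ⟨hZmem ζ hζ, ζ, hζ, rfl⟩
  have hreal := realisationsDead_of_caseALeaf hleaf Zo hZomem
  set Yo := (List.range L).map fun t => (s0 + a - 1 + t) % p with hYo
  have hYocast : ∀ t : ℕ, ((((s0 + a - 1 + t) % p : ℕ)) : ZMod p) = y + t := fun t => by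
    rw [cast_mod_self, show s0 + a - 1 + t = s0 + (a - 1) + t by omega]
    push_cast; rw [hs0cast]; ring
  have hYo_mem : ∀ v, v ∈ Yo ↔ ∃ e ∈ DU B C (univ.erase 0), e.val = v := by
    intro v; rw [hYo, List.mem_map]
    constructor
    · rintro ⟨t, ht, rfl⟩
      refine ⟨y + t, by rw [hY]; exact mem_image.2 ⟨t, mem_range.2 (List.mem_range.1 ht), rfl⟩, ?_⟩; rw [← hYocast, ZMod.val_natCast, Nat.mod_eq_of_lt (Nat.mod_lt _ hp0)]
    · rintro ⟨e, he, rfl⟩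
      rw [hY, mem_image] at he
      obtain ⟨t, ht, rfl⟩ := he
      refine ⟨t, List.mem_range.2 (mem_range.1 ht), ?_⟩
      have := hYocast t
      rw [← this, ZMod.val_natCast, Nat.mod_eq_of_lt (Nat.mod_lt _ hp0)]
  have hYo_nd : Yo.Nodup := by
    rw [hYo]
    refine List.Nodup.map_on (fun t ht t' ht' htt => ?_) (List.nodup_range (n := L))
    have h' := congrArg (fun n : ℕ => (n : ZMod p)) htt
    simp only [hYocast, add_right_inj] at h'
    have := congrArg ZMod.val h'
    rwa [ZMod.val_natCast_of_lt (by have := List.mem_range.1 ht; omega),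
      ZMod.val_natCast_of_lt (by have := List.mem_range.1 ht'; omega)] at this
  have hDmem : ∀ cc ∈ C 1, ∀ b ∈ B 1, cc - b ∈ DU B C (univ.erase 0) := fun cc hcc b hb => by
    rw [h1]; exact Finset.mem_biUnion.2 ⟨1, mem_singleton_self 1, mem_D.2 ⟨b, hb, cc, hcc, rfl⟩⟩
  have hDAmem : ∀ cc ∈ C 1, ∀ x ∈ A 1, cc - x ∈ DU A C (univ.erase 0) := fun cc hcc x hx => by
    rw [h1]; exact Finset.mem_biUnion.2 ⟨1, mem_singleton_self 1, mem_D.2 ⟨x, hx, cc, hcc, rfl⟩⟩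
  set C' := Yo.filter fun v => decide (v ∈ (C 1).image ZMod.val) with hC'
  have hC'_mem : ∀ v, v ∈ C' ↔ ∃ cc ∈ C 1, cc.val = v := by
    intro v; rw [hC', List.mem_filter, decide_eq_true_eq, mem_image]
    constructor
    · exact fun h => h.2
    · rintro ⟨cc, hcc, rfl⟩
      exact ⟨(hYo_mem _).2 ⟨cc - 0, hDmem cc hcc 0 hB10, by rw [sub_zero]⟩, cc, hcc, rfl⟩
  have hC'sub : C' ∈ Yo.sublistsLen c₀ := by
    rw [← hc₀, ← card_image_of_injective (C 1) (ZMod.val_injective p)]; exact filter_mem_sublistsLen Yo hYo_nd _ fun v hv => by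
      obtain ⟨cc, hcc, rfl⟩ := mem_image.1 hv
      exact (hYo_mem _).2 ⟨cc - 0, hDmem cc hcc 0 hB10, by rw [sub_zero]⟩
  set candB := (List.range p).filter fun β => C'.all fun cc => tb (maskOf Yo) ((cc + p - β) % p) with hcandB
  have hcandB_mem : ∀ b ∈ B 1, b.val ∈ candB := by
    intro b hb; rw [hcandB, List.mem_filter, List.mem_range, List.all_eq_true]
    refine ⟨b.val_lt, fun cc hcc => ?_⟩
    obtain ⟨c1, hc1, rfl⟩ := (hC'_mem cc).1 hcc
    rw [tb_maskOf, val_sub_eq_mod]; exact (hYo_mem _).2 ⟨c1 - b, hDmem c1 hc1 b hb, rfl⟩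
  have h0cand : (0 : ℕ) ∈ candB := by have := hcandB_mem 0 hB10; rwa [ZMod.val_zero] at this
  set B1 := (candB.filter fun x => !(Nat.beq x 0)).filter fun v => decide (v ∈ (B 1).image ZMod.val) with hB1
  have hB1_mem : ∀ v, v ∈ B1 ↔ ∃ b ∈ B 1, b ≠ 0 ∧ b.val = v := by
    intro v; rw [hB1, List.mem_filter, List.mem_filter, decide_eq_true_eq, mem_image]
    constructor
    · rintro ⟨⟨_, hne⟩, b, hb, rfl⟩
      refine ⟨b, hb, fun hb0 => ?_, rfl⟩
      rw [hb0, ZMod.val_zero] at hne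
      exact Bool.noConfusion hne
    · rintro ⟨b, hb, hne, rfl⟩
      refine ⟨⟨hcandB_mem b hb, ?_⟩, b, hb, rfl⟩
      cases hbeq : Nat.beq b.val 0
      · rfl
      · exact absurd ((ZMod.val_eq_zero b).1 (Nat.eq_of_beq_eq_true hbeq)) hne
  have hB1sub : B1 ∈ (candB.filter fun x => !(Nat.beq x 0)).sublistsLen (b₀ - 1) := by
    have hB1' : B1 = (candB.filter fun x => !(Nat.beq x 0)).filter fun v => decide (v ∈ ((B 1).erase 0).image ZMod.val) := by
      rw [hB1]
      refine List.filter_congr fun v hv => ?_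
      rw [List.mem_filter] at hv
      simp only [decide_eq_decide, mem_image, mem_erase]
      constructor
      · rintro ⟨b, hb, rfl⟩
        refine ⟨b, ⟨fun hb0 => ?_, hb⟩, rfl⟩
        rw [hb0, ZMod.val_zero] at hv; exact Bool.noConfusion hv.2
      · rintro ⟨b, ⟨-, hb⟩, rfl⟩; exact ⟨b, hb, rfl⟩
    rw [hB1', ← hb₀, ← card_erase_of_mem hB10, ← card_image_of_injective ((B 1).erase 0) (ZMod.val_injective p)]
    refine filter_mem_sublistsLen _ (List.nodup_range.filter _ |>.filter _) _ fun v hv => ?_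
    obtain ⟨b, hb, rfl⟩ := mem_image.1 hv
    rw [List.mem_filter]
    refine ⟨hcandB_mem b (mem_erase.1 hb).2, ?_⟩
    cases hbeq : Nat.beq b.val 0
    · rfl
    · exact absurd ((ZMod.val_eq_zero b).1 (Nat.eq_of_beq_eq_true hbeq)) (mem_erase.1 hb).1
  have h0B1_mem : ∀ v, v ∈ (0 :: B1) ↔ ∃ b ∈ B 1, b.val = v := by
    intro v; rw [List.mem_cons, hB1_mem]
    constructor
    · rintro (rfl | ⟨b, hb, -, rfl⟩)
      · exact ⟨0, hB10, ZMod.val_zero⟩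
      · exact ⟨b, hb, rfl⟩
    · rintro ⟨b, hb, rfl⟩
      by_cases hb0 : b = 0
      · left; rw [hb0, ZMod.val_zero]
      · right; exact ⟨b, hb, hb0, rfl⟩
  have hA'cand_mem : ∀ x ∈ A 1, x.val ∈ (List.range p).filter fun α => C'.all fun cc => tb (maskOf Zo) ((cc + p - α) % p) := by
    intro x hx; rw [List.mem_filter, List.mem_range, List.all_eq_true]
    refine ⟨x.val_lt, fun cc hcc => ?_⟩
    obtain ⟨c1, hc1, rfl⟩ := (hC'_mem cc).1 hcc
    rw [tb_maskOf, val_sub_eq_mod]; exact (hZo_mem _).2 ⟨c1 - x, hDAmem c1 hc1 x hx, rfl⟩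
  set A' := ((List.range p).filter fun α => C'.all fun cc => tb (maskOf Zo) ((cc + p - α) % p)).filter
    fun v => decide (v ∈ (A 1).image ZMod.val) with hA'
  have hA'_mem : ∀ v, v ∈ A' ↔ ∃ x ∈ A 1, x.val = v := by
    intro v; rw [hA', List.mem_filter, decide_eq_true_eq, mem_image]
    constructor
    · exact fun h => h.2
    · rintro ⟨x, hx, rfl⟩; exact ⟨hA'cand_mem x hx, x, hx, rfl⟩
  have hA'sub : A' ∈ ((List.range p).filter fun α => C'.all fun cc => tb (maskOf Zo) ((cc + p - α) % p)).sublistsLen a₀ := by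
    rw [← ha₀, ← card_image_of_injective (A 1) (ZMod.val_injective p)]; exact filter_mem_sublistsLen _ (List.nodup_range.filter _) _ fun v hv => by
      obtain ⟨x, hx, rfl⟩ := mem_image.1 hv
      exact hA'cand_mem x hx
  have hD : (C'.flatMap fun cc => (0 :: B1).map fun β => (cc + p - β) % p).Nodup :=
    nodup_flatMap_diff C' (0 :: B1) (C 1) (B 1) (hYo_nd.filter _) (by
        refine List.nodup_cons.2 ⟨fun h0 => ?_, ((List.nodup_range.filter _).filter _).filter _⟩
        obtain ⟨b, _, hne, hb0⟩ := (hB1_mem 0).1 h0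
        exact hne ((ZMod.val_eq_zero b).1 hb0))
      hC'_mem h0B1_mem (fun e he e' he' f hf f' hf' hh => by
        obtain ⟨h1', h2'⟩ := sub_injOn_CB hS hA 1 hf hf' he he' hh; exact ⟨h2', h1'⟩)
  have hDZ : (C'.flatMap fun cc => A'.map fun α => (cc + p - α) % p).Nodup :=
    nodup_flatMap_diff C' A' (C 1) (A 1) (hYo_nd.filter _) ((List.nodup_range.filter _).filter _) hC'_mem hA'_mem
      (fun e he e' he' f hf f' hf' hh => by
        obtain ⟨h1', h2'⟩ := sub_injOn_CA hS hB 1 hf hf' he he' hh; exact ⟨h2', h1'⟩)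
  have hX : (A'.flatMap fun α => (0 :: B1).map fun β => (α + p - β) % p).Nodup :=
    nodup_flatMap_diff A' (0 :: B1) (A 1) (B 1) ((List.nodup_range.filter _).filter _) (by
        refine List.nodup_cons.2 ⟨fun h0 => ?_, ((List.nodup_range.filter _).filter _).filter _⟩
        obtain ⟨b, _, hne, hb0⟩ := (hB1_mem 0).1 h0
        exact hne ((ZMod.val_eq_zero b).1 hb0))
      hA'_mem h0B1_mem (fun e he e' he' f hf f' hf' hh => sub_injOn_AB hS hC 1 he he' hf hf' hh)
  have h0' : (0 : ℕ) ∈ (List.range p).filter fun β => C'.all fun cc => tb (maskOf Yo) ((cc + p - β) % p) := h0cand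
  have hfalse := isSTPPb_false_of_realisationsDead hreal C' B1 A' hC'sub h0' hB1sub hD hA'sub hDZ hX
  have hR_mem : ∀ v, v ∈ [0] ++ rs.map Prod.fst → ∃ cc ∈ C 0, cc.val = v := by
    intro v hv
    rw [List.mem_append, List.mem_singleton, List.mem_map] at hv
    rcases hv with rfl | ⟨x, hx, rfl⟩
    · exact ⟨0, hC00, ZMod.val_zero⟩
    · obtain ⟨hx1, _⟩ := (hmemrs x).1 hx
      obtain ⟨cc, hcc, _, hcv⟩ := (hRSmem _).1 hx1
      exact ⟨cc, hcc, hcv⟩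
  have htrue : isSTPPb p [(List.range a, Q, [0] ++ rs.map Prod.fst), (A', 0 :: B1, C')] = true := by
    refine isSTPPb_of_isSTPP hS _ rfl ?_ ?_ ?_
    · intro i v hv
      fin_cases i
      · change v ∈ List.range a at hv
        have hva := List.mem_range.1 hv
        exact ⟨(v : ZMod p), hA0mem v hva, ZMod.val_natCast_of_lt (by omega)⟩
      · change v ∈ A' at hv
        exact (hA'_mem v).1 hv
    · intro i v hv
      fin_cases i
      · change v ∈ Q at hv
        exact (hQmem v).1 hv
      · change v ∈ (0 :: B1) at hv
        exact (h0B1_mem v).1 hv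
    · intro i v hv
      fin_cases i
      · change v ∈ [0] ++ rs.map Prod.fst at hv
        exact hR_mem v hv
      · change v ∈ C' at hv
        exact (hC'_mem v).1 hv
  rw [htrue] at hfalse
  exact Bool.noConfusion hfalse

end Summit.MatrixMultiplication.OmegaCensus.CubeNB.S2
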